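import Literature.NumberTheory.ComplexMultiplication.CMTypeRankCommonConstituent
import Literature.NumberTheory.ComplexMultiplication.CMTypeRankTypeConjugation
import HarnessLib

/-!
# The DEGENERATE half of the quadratic tower: a type of the bottom slot stabilised by the stabiliser of an
# unsplit fibre makes the family rank collapse to the rank of the top slot

Companion of `NumberTheory/ComplexMultiplication/CMTypeRankQuadraticTower` (stabiliser separation for a quadratic tower:
the NONDEGENERATE half) in the same abstract setting, now for a two-slot family `Σ` on `E_{i₀} ⊔ E_{i₁}` together with an
auxiliary `G`-set `X` and an equivariant `π : E_{i₁} → X` (in the application: `E_{i₀} = Hom(K_S, ℂ)` for a non-Galois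
quartic CM field `K_S`, `E_{i₁} = Hom(K_F, ℂ)` for an octic CM field `K_F` containing a copy `k'` of the REFLEX field of
`K_S`, `X = Hom(k', ℂ)`, `π` = restriction).  Data: a point `x₀ ∈ X` whose fibre `{y₀, y₀'}` lies inside the type
`Θ = Φ_{i₁}` ("unsplit"), a point `x₁` whose fibre `{y₁ ∈ Θ, y₁' ∉ Θ}` is split, `X = {x₀, ρx₀, x₁, ρx₁}`, and the
DEGENERACY HYPOTHESIS: every `g ∈ G` fixing `x₀` stabilises the type `Ψ = Φ_{i₀}` (in the application: the reflex field of
`(K_S, Ψ)` is the image `ψ₀(k')` of the unsplit embedding).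

> **Theorem** (`typeRank_sigmaType_eq_of_stabilizer_le`).  `rank(Σ) = rank(Θ)`; hence (`typeRank_sigmaType_lt_of_stabilizer_le`)
> `Σ` is DEGENERATE: `rank(Σ) − 1 < (rank Ψ − 1) + (rank Θ − 1)` as soon as `E_{i₀} ≠ ∅`.

PROOF.  The degeneracy hypothesis makes the incidence `R(z, x) :⟺ z ∈ gΨ for g x₀ = x` well defined and `G`-invariant,
with `R(·, x₀) = Ψ`, `R(·, ρx₀) = Ψᶜ`.  The equivariant map `L f (z) = Σ_{y : R(z, π y)} f(y)` satisfies
`L(u_g(Θ)) = 2 u_g(Ψ)`: fibre by fibre, the fibre of `x₀` contributes `2·[z ∈ Ψ]`, that of `ρx₀` contributes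
`−2·[z ∉ Ψ]`, and the split fibres of `x₁`, `ρx₁` contribute `0`.  Hence on `U(Σ) = span{u_g(Σ)}` the `i₀`-restriction
is `½ L ∘` (the `i₁`-restriction): the `i₁`-restriction is injective on `U(Σ)` with image `U(Θ)`, so
`dim U(Σ) = dim U(Θ)`.  This is the mechanism of the exceptional Hodge classes on `S × F` for a simple CM surface `S`
and a simple CM fourfold `F` whose field contains the reflex field of `S` "on the unsplit side"
(`Summits/HodgeConjecture/CorCM/QuarticCMReflexInOcticHodge`).  Theorems only; no definition, no named fact, no `sorry`.

## References

* [Gordon1999HodgeAVSurvey] B. B. Gordon, *A survey of the Hodge conjecture for abelian varieties*, 7.5–7.7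
  (`rank Hg(A × B) < rank Hg(A) + rank Hg(B)`: exceptional classes on products).
* [MoonenZarhin1999LowDim] B. Moonen, Yu. Zarhin, *Hodge classes on abelian varieties of low dimension*, Math. Ann. 315
  (1999) ("Hodge groups of simple abelian surfaces of CM-type"; Thm. (0.2) (a): the `k ↪ End⁰` obstruction).
* [Shimura1998] G. Shimura, *Abelian Varieties with Complex Multiplication and Modular Functions*, §8.3–8.4 (reflex
  fields of quartic CM fields).
-/

set_option autoImplicit false

noncomputable section

open scoped BigOperators

namespace Literature.NumberTheory.ComplexMultiplication

variable {G : Type*} [Group G] {I : Type*} {E : I → Type*} [∀ i, MulAction G (E i)] {X : Type*} [MulAction G X]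

/-! ### §1 The incidence relation defined by a stabilised type -/

section Incidence

variable {Z : Type*} [MulAction G Z] {Ψ : Set Z} {x₀ : X}

/-- **Well-definedness of the incidence.**  If every `g` fixing `x₀` stabilises `Ψ`, then `z ∈ gΨ` (`g⁻¹z ∈ Ψ`) does not
depend on the choice of `g` with `g x₀ = x`. [cite: Shimura1998, §8.3 Prop. 28] -/
private theorem inv_smul_mem_iff_of_smul_eq (hdeg : ∀ g : G, g • x₀ = x₀ → ∀ z : Z, g • z ∈ Ψ ↔ z ∈ Ψ)
    {g g' : G} {x : X} (hg : g • x₀ = x) (hg' : g' • x₀ = x) (z : Z) : g⁻¹ • z ∈ Ψ ↔ g'⁻¹ • z ∈ Ψ := by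
  have hfix : (g'⁻¹ * g) • x₀ = x₀ := by rw [mul_smul, hg, ← hg', inv_smul_smul]
  rw [← hdeg _ hfix (g⁻¹ • z), mul_smul, smul_inv_smul]

/-- The incidence `R(z, x) :⟺ ∀ g, g x₀ = x → g⁻¹ z ∈ Ψ` in existential form (transitivity on `X`).
[cite: Shimura1998, §8.3 Prop. 28] -/
private theorem incidence_iff_exists (htrans : ∀ x : X, ∃ g : G, g • x₀ = x)
    (hdeg : ∀ g : G, g • x₀ = x₀ → ∀ z : Z, g • z ∈ Ψ ↔ z ∈ Ψ) (z : Z) (x : X) :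
    (∀ g : G, g • x₀ = x → g⁻¹ • z ∈ Ψ) ↔ ∃ g : G, g • x₀ = x ∧ g⁻¹ • z ∈ Ψ := by
  obtain ⟨g₀, hg₀⟩ := htrans x
  exact ⟨fun hall => ⟨g₀, hg₀, hall g₀ hg₀⟩,
    fun ⟨g, hg, hz⟩ g' hg' => (inv_smul_mem_iff_of_smul_eq hdeg hg hg' z).1 hz⟩

/-- **`G`-invariance of the incidence**: `R(kz, kx) ⟺ R(z, x)`. [cite: Shimura1998, §8.3 Prop. 28] -/
private theorem incidence_smul_iff (htrans : ∀ x : X, ∃ g : G, g • x₀ = x)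
    (hdeg : ∀ g : G, g • x₀ = x₀ → ∀ z : Z, g • z ∈ Ψ ↔ z ∈ Ψ) (k : G) (z : Z) (x : X) :
    (∀ g : G, g • x₀ = k • x → g⁻¹ • (k • z) ∈ Ψ) ↔ ∀ g : G, g • x₀ = x → g⁻¹ • z ∈ Ψ := by
  rw [incidence_iff_exists htrans hdeg, incidence_iff_exists htrans hdeg]
  constructor
  · rintro ⟨g, hg, hz⟩
    refine ⟨k⁻¹ * g, by rw [mul_smul, hg, inv_smul_smul], ?_⟩
    rw [mul_inv_rev, inv_inv, mul_smul]
    exact hz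
  · rintro ⟨g, hg, hz⟩
    refine ⟨k * g, by rw [mul_smul, hg], ?_⟩
    rw [mul_inv_rev, mul_smul, inv_smul_smul]
    exact hz

/-- `R(·, x₀) = Ψ`. [cite: Shimura1998, §8.3 Prop. 28] -/
private theorem incidence_base_iff (hdeg : ∀ g : G, g • x₀ = x₀ → ∀ z : Z, g • z ∈ Ψ ↔ z ∈ Ψ) (z : Z) :
    (∀ g : G, g • x₀ = x₀ → g⁻¹ • z ∈ Ψ) ↔ z ∈ Ψ := by
  constructor
  · intro hall
    simpa using hall 1 (one_smul G x₀)
  · intro hz g hg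
    exact (hdeg g⁻¹ (inv_smul_eq_iff.2 hg.symm) z).2 hz

end Incidence

/-! ### §2 The rank collapse -/

section Collapse

variable [∀ i, Fintype (E i)] {ρ : G} {Φ : ∀ i, Set (E i)} {i₀ i₁ : I}

/-- `u_g(Θ)(ρy) = −u_g(Θ)(y)`. [cite: Shimura1998, §32.10 (proof)] -/
private theorem antiVec_rho_smul {Y : Type*} [MulAction G Y] {Θ : Set Y} (hΘ : IsCMTypeWith ρ Θ) (g : G) (y : Y) :
    antiVec Θ g (ρ • y) = -antiVec Θ g y := by
  simp only [antiVec, hΘ.translateInd_rho_smul]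
  ring

/-- **The rank of the family equals the rank of the top slot** under the degeneracy hypothesis (see the module
docstring for the data).  [cite: Gordon1999HodgeAVSurvey, 7.5–7.7] [cite: MoonenZarhin1999LowDim, Thm. (0.2) (a)] -/
theorem finrank_antiSpan_sigmaType_eq_of_stabilizer_le [Fintype X] (h : ∀ i, IsCMTypeWith ρ (Φ i)) (h01 : i₀ ≠ i₁)
    (hI : ∀ k, k = i₀ ∨ k = i₁) (π : E i₁ → X) (hπ : ∀ (g : G) (y : E i₁), π (g • y) = g • π y)
    (hfib : ∀ y₁ y₂ y₃ : E i₁, π y₁ = π y₂ → π y₂ = π y₃ → y₁ = y₂ ∨ y₂ = y₃ ∨ y₁ = y₃)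
    {x₀ : X} (htrans : ∀ x : X, ∃ g : G, g • x₀ = x)
    (hdeg : ∀ g : G, g • x₀ = x₀ → ∀ z : E i₀, g • z ∈ Φ i₀ ↔ z ∈ Φ i₀)
    {y₀ y₀' y₁ y₁' : E i₁} (hy₀ : π y₀ = x₀) (hy₀' : π y₀' = x₀) (h00 : y₀ ≠ y₀') (hΘ₀ : y₀ ∈ Φ i₁)
    (hΘ₀' : y₀' ∈ Φ i₁) (hy₁' : π y₁' = π y₁) (h11 : y₁ ≠ y₁') (hΘ₁ : y₁ ∈ Φ i₁) (hΘ₁' : y₁' ∉ Φ i₁)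
    (hX : ∀ x : X, x = x₀ ∨ x = ρ • x₀ ∨ x = π y₁ ∨ x = ρ • π y₁) :
    Module.finrank ℚ (antiSpan G (sigmaType Φ)) = Module.finrank ℚ (antiSpan G (Φ i₁)) := by
  classical
  -- notation
  set R : E i₀ → X → Prop := fun z x => ∀ g : G, g • x₀ = x → g⁻¹ • z ∈ Φ i₀ with hR
  have hRx₀ : ∀ z, R z x₀ ↔ z ∈ Φ i₀ := fun z => incidence_base_iff hdeg z
  have hRsmul : ∀ (k : G) (z : E i₀) (x : X), R z (k • x) ↔ R (k⁻¹ • z) x := fun k z x => by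
    have h1 := incidence_smul_iff htrans hdeg k (k⁻¹ • z) x
    rwa [smul_inv_smul] at h1
  have hρX : ∀ y : E i₁, ρ • ρ • π y = π y := fun y => by rw [← hπ, ← hπ, (h i₁).invol]
  have hRρx₀ : ∀ z, R z (ρ • x₀) ↔ z ∉ Φ i₀ := fun z => by
    have hρinv : ρ⁻¹ • z = ρ • z := by
      rw [inv_smul_eq_iff, (h i₀).invol]
    rw [hRsmul, hρinv, hRx₀, (h i₀).rho_smul_mem_iff]
  -- fibres of `π`
  have hx₀ρ : x₀ ≠ ρ • x₀ := by
    intro heq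
    have hz : π (ρ • y₀) = π y₀ := by rw [hπ, hy₀, ← heq]
    rcases hfib (ρ • y₀) y₀ y₀' hz (hy₀.trans hy₀'.symm) with h' | h' | h'
    · exact (h i₁).rho_smul_ne y₀ h'
    · exact h00 h'
    · rw [← h'] at hΘ₀'
      exact (h i₁).rho_smul_mem_iff y₀ |>.1 hΘ₀' hΘ₀
  have hfib₀ : ∀ y, π y = x₀ → y = y₀ ∨ y = y₀' := fun y hy => by
    rcases hfib y y₀ y₀' (hy.trans hy₀.symm) (hy₀.trans hy₀'.symm) with h' | h' | h'
    · exact Or.inl h'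
    · exact absurd h' h00
    · exact Or.inr h'
  have hfib₁ : ∀ y, π y = π y₁ → y = y₁ ∨ y = y₁' := fun y hy => by
    rcases hfib y y₁ y₁' hy hy₁'.symm with h' | h' | h'
    · exact Or.inl h'
    · exact absurd h' h11
    · exact Or.inr h'
  have hfibρ : ∀ {a b b' : E i₁} (hab : ∀ y, π y = π b → y = b ∨ y = b') (y : E i₁), π y = ρ • π a → π a = π b →
      y = ρ • b ∨ y = ρ • b' := by
    intro a b b' hab y hy hab'
    have hz : π (ρ • y) = π b := by rw [hπ, hy, hab', ← hπ, ← hπ, (h i₁).invol]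
    rcases hab (ρ • y) hz with h' | h'
    · left; rw [← h', (h i₁).invol]
    · right; rw [← h', (h i₁).invol]
  -- fibre sums `ν(x) = Σ_{π y = x} u_1(Θ)(y)` on the four points
  set u : E i₁ → ℚ := antiVec (Φ i₁) (1 : G) with hu
  have hu_mem : ∀ y, y ∈ Φ i₁ → u y = 1 := fun y hy => by
    simp only [hu, antiVec, translateInd_of_mem (show (1 : G) • y ∈ Φ i₁ by rwa [one_smul])]; norm_num
  have hu_nmem : ∀ y, y ∉ Φ i₁ → u y = -1 := fun y hy => by
    simp only [hu, antiVec, translateInd_of_not_mem (show (1 : G) • y ∉ Φ i₁ by rwa [one_smul])]; norm_num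
  have hν : ∀ x : X, ∑ y ∈ Finset.univ.filter (fun y => π y = x), u y =
      (if x = x₀ then 2 else 0) + (if x = ρ • x₀ then -2 else 0) := by
    intro x
    rcases hX x with hx | hx | hx | hx <;> rw [hx]
    · rw [if_pos rfl, if_neg hx₀ρ, add_zero]
      have hset : Finset.univ.filter (fun y => π y = x₀) = {y₀, y₀'} := by
        ext y; simp only [Finset.mem_filter, Finset.mem_univ, true_and, Finset.mem_insert, Finset.mem_singleton]
        exact ⟨hfib₀ y, fun h' => by rcases h' with rfl | rfl <;> assumption⟩
      rw [hset, Finset.sum_pair h00, hu_mem y₀ hΘ₀, hu_mem y₀' hΘ₀']; norm_num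
    · rw [if_neg (Ne.symm hx₀ρ), if_pos rfl, zero_add]
      have hne : ρ • y₀ ≠ ρ • y₀' := fun h' => h00 (smul_left_cancel ρ h')
      have hset : Finset.univ.filter (fun y => π y = ρ • x₀) = {ρ • y₀, ρ • y₀'} := by
        ext y; simp only [Finset.mem_filter, Finset.mem_univ, true_and, Finset.mem_insert, Finset.mem_singleton]
        refine ⟨fun hy => hfibρ (a := y₀) (fun y' hy' => hfib₀ y' (hy'.trans hy₀)) y (by rw [hy₀]; exact hy) rfl,
          fun h' => ?_⟩
        rcases h' with rfl | rfl
        · rw [hπ, hy₀]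
        · rw [hπ, hy₀']
      rw [hset, Finset.sum_pair hne, hu, antiVec_rho_smul (h i₁), antiVec_rho_smul (h i₁), ← hu,
        hu_mem y₀ hΘ₀, hu_mem y₀' hΘ₀']; norm_num
    · -- the split fibre of `x₁ = π y₁`
      have hx₁₀ : π y₁ ≠ x₀ := fun h' => hΘ₁' (by
        rcases hfib₀ y₁' (hy₁'.trans h') with h'' | h'' <;> rw [h''] <;> assumption)
      have hx₁₀' : π y₁ ≠ ρ • x₀ := by
        intro h'
        rcases hfibρ (a := y₀) (fun y' hy' => hfib₀ y' (hy'.trans hy₀)) y₁ (by rw [hy₀]; exact h') rfl with h'' | h''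
        · rw [h''] at hΘ₁; exact (h i₁).rho_smul_mem_iff y₀ |>.1 hΘ₁ hΘ₀
        · rw [h''] at hΘ₁; exact (h i₁).rho_smul_mem_iff y₀' |>.1 hΘ₁ hΘ₀'
      rw [if_neg hx₁₀, if_neg hx₁₀', add_zero]
      have hset : Finset.univ.filter (fun y => π y = π y₁) = {y₁, y₁'} := by
        ext y; simp only [Finset.mem_filter, Finset.mem_univ, true_and, Finset.mem_insert, Finset.mem_singleton]
        exact ⟨hfib₁ y, fun h' => by rcases h' with rfl | rfl; rfl; exact hy₁'⟩
      rw [hset, Finset.sum_pair h11, hu_mem y₁ hΘ₁, hu_nmem y₁' hΘ₁']; norm_num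
    · -- the split fibre of `ρ x₁`
      have hx₁₀ : ρ • π y₁ ≠ x₀ := by
        intro h'
        have h'' : π y₁ = ρ • x₀ := by rw [← h', hρX]
        rcases hfibρ (a := y₀) (fun y' hy' => hfib₀ y' (hy'.trans hy₀)) y₁ (by rw [hy₀]; exact h'') rfl with h3 | h3
        · rw [h3] at hΘ₁; exact (h i₁).rho_smul_mem_iff y₀ |>.1 hΘ₁ hΘ₀
        · rw [h3] at hΘ₁; exact (h i₁).rho_smul_mem_iff y₀' |>.1 hΘ₁ hΘ₀'
      have hx₁₀' : ρ • π y₁ ≠ ρ • x₀ := by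
        intro h'
        have h'' : π y₁ = x₀ := smul_left_cancel ρ h'
        exact hΘ₁' (by rcases hfib₀ y₁' (hy₁'.trans h'') with h3 | h3 <;> rw [h3] <;> assumption)
      rw [if_neg hx₁₀, if_neg hx₁₀', add_zero]
      have hne : ρ • y₁ ≠ ρ • y₁' := fun h' => h11 (smul_left_cancel ρ h')
      have hset : Finset.univ.filter (fun y => π y = ρ • π y₁) = {ρ • y₁, ρ • y₁'} := by
        ext y; simp only [Finset.mem_filter, Finset.mem_univ, true_and, Finset.mem_insert, Finset.mem_singleton]
        refine ⟨fun hy => hfibρ (a := y₁) hfib₁ y hy rfl, fun h' => ?_⟩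
        rcases h' with rfl | rfl
        · rw [hπ]
        · rw [hπ, hy₁']
      rw [hset, Finset.sum_pair hne, hu, antiVec_rho_smul (h i₁), antiVec_rho_smul (h i₁), ← hu,
        hu_mem y₁ hΘ₁, hu_nmem y₁' hΘ₁']; norm_num
  -- the key identity `Σ_{y : R(z, π y)} u_1(Θ)(y) = 2 u_1(Ψ)(z)`
  have hkey₁ : ∀ z : E i₀, ∑ y, (if R z (π y) then u y else 0) = 2 * antiVec (Φ i₀) (1 : G) z := by
    intro z
    have hfw : ∑ y, (if R z (π y) then u y else 0) =
        ∑ x, ∑ y ∈ Finset.univ.filter (fun y => π y = x), (if R z (π y) then u y else 0) :=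
      (Finset.sum_fiberwise_of_maps_to (g := π) (fun y _ => Finset.mem_univ (π y)) _).symm
    rw [hfw]
    have hinner : ∀ x, ∑ y ∈ Finset.univ.filter (fun y => π y = x), (if R z (π y) then u y else 0) =
        if R z x then ∑ y ∈ Finset.univ.filter (fun y => π y = x), u y else 0 := by
      intro x
      split_ifs with hzx
      · refine Finset.sum_congr rfl fun y hy => ?_
        rw [(Finset.mem_filter.1 hy).2, if_pos hzx]
      · refine Finset.sum_eq_zero fun y hy => ?_
        rw [(Finset.mem_filter.1 hy).2, if_neg hzx]
    simp only [hinner, hν]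
    rw [Fintype.sum_eq_add x₀ (ρ • x₀) hx₀ρ (fun x hx => by
      rw [if_neg hx.1, if_neg hx.2, add_zero]; split_ifs <;> rfl)]
    simp only [if_neg hx₀ρ, if_neg (Ne.symm hx₀ρ), add_zero, zero_add]
    simp only [hRx₀, hRρx₀, antiVec]
    by_cases hz : z ∈ Φ i₀
    · rw [if_pos hz, if_neg (not_not.2 hz), translateInd_of_mem (show (1 : G) • z ∈ Φ i₀ by rwa [one_smul])]
      norm_num
    · rw [if_neg hz, if_pos hz, translateInd_of_not_mem (show (1 : G) • z ∉ Φ i₀ by rwa [one_smul])]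
      norm_num
  -- transport to every `g`: `Σ_{y : R(z, π y)} u_g(Θ)(y) = 2 u_g(Ψ)(z)`
  have hkey : ∀ (g : G) (z : E i₀),
      ∑ y, (if R z (π y) then antiVec (Φ i₁) g y else 0) = 2 * antiVec (Φ i₀) g z := by
    intro g z
    have h1 : ∑ y, (if R z (π y) then antiVec (Φ i₁) g y else 0) =
        ∑ y, (if R (g • z) (π y) then u y else 0) := by
      refine (Fintype.sum_equiv (MulAction.toPerm g) _ _ fun y => ?_)
      rw [MulAction.toPerm_apply, hπ, hRsmul, inv_smul_smul, hu, antiVec_apply_smul, one_mul]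
    rw [h1, hkey₁, antiVec_apply_smul, one_mul]
  -- on `U(Σ)`: the `i₀`-restriction is `½ L ∘` the `i₁`-restriction
  set M := antiSpan G (sigmaType Φ) with hM
  have hgraph : ∀ m ∈ M, ∀ z : E i₀,
      ∑ y, (if R z (π y) then m ⟨i₁, y⟩ else 0) = 2 * m ⟨i₀, z⟩ := by
    intro m hm
    induction hm using Submodule.span_induction with
    | mem f hf =>
      obtain ⟨g, rfl⟩ := hf
      intro z
      simp only [antiVec_sigmaType]
      exact hkey g z
    | zero => intro z; simp
    | add f f' _ _ hf hf' =>
      intro z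
      simp only [Pi.add_apply]
      rw [mul_add, ← hf z, ← hf' z, ← Finset.sum_add_distrib]
      exact Finset.sum_congr rfl fun y _ => by split_ifs <;> simp
    | smul c f _ hf =>
      intro z
      simp only [Pi.smul_apply, smul_eq_mul]
      rw [mul_left_comm, ← hf z, Finset.mul_sum]
      exact Finset.sum_congr rfl fun y _ => by split_ifs <;> simp
  -- the `i₁`-restriction is injective on `U(Σ)`
  set p : ((Σ k, E k) → ℚ) →ₗ[ℚ] (E i₁ → ℚ) := LinearMap.funLeft ℚ ℚ (Sigma.mk i₁) with hp
  have hinj : Function.Injective (p ∘ₗ M.subtype) := by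
    rw [← LinearMap.ker_eq_bot, LinearMap.ker_eq_bot']
    rintro ⟨m, hm⟩ hm0
    apply Subtype.ext
    funext w
    obtain ⟨k, s⟩ := w
    have hY : ∀ y : E i₁, m ⟨i₁, y⟩ = 0 := fun y => congrFun hm0 y
    rcases hI k with rfl | rfl
    · have h2 := hgraph m hm s
      simp only [hY, ite_self, Finset.sum_const_zero] at h2
      change m ⟨k, s⟩ = 0
      linarith
    · exact hY s
  have hrange : LinearMap.range (p ∘ₗ M.subtype) = antiSpan G (Φ i₁) := by
    rw [LinearMap.range_comp, Submodule.range_subtype, hp, hM, map_funLeft_mk_antiSpan_sigmaType]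
  rw [← hrange]
  exact (LinearMap.finrank_range_of_inj hinj).symm

/-- **Degenerate half of the quadratic tower**: under the degeneracy hypothesis `rank(Σ) = rank(Θ)`, so
`rank(Σ) + 2 ≤ rank(Ψ) + rank(Θ)` fails to be additive and `Σ` is DEGENERATE (`rank(Σ) < |E_{i₀} ⊔ E_{i₁}|/2 + 1`).
[cite: Gordon1999HodgeAVSurvey, 7.5–7.7] [cite: MoonenZarhin1999LowDim, Thm. (0.2) (a)] -/
theorem typeRank_sigmaType_lt_of_stabilizer_le [Fintype I] [Fintype X] [Nonempty (E i₀)] [Nonempty (E i₁)]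
    (h : ∀ i, IsCMTypeWith ρ (Φ i))
    (h01 : i₀ ≠ i₁) (hI : ∀ k, k = i₀ ∨ k = i₁) (π : E i₁ → X) (hπ : ∀ (g : G) (y : E i₁), π (g • y) = g • π y)
    (hfib : ∀ y₁ y₂ y₃ : E i₁, π y₁ = π y₂ → π y₂ = π y₃ → y₁ = y₂ ∨ y₂ = y₃ ∨ y₁ = y₃)
    {x₀ : X} (htrans : ∀ x : X, ∃ g : G, g • x₀ = x)
    (hdeg : ∀ g : G, g • x₀ = x₀ → ∀ z : E i₀, g • z ∈ Φ i₀ ↔ z ∈ Φ i₀)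
    {y₀ y₀' y₁ y₁' : E i₁} (hy₀ : π y₀ = x₀) (hy₀' : π y₀' = x₀) (h00 : y₀ ≠ y₀') (hΘ₀ : y₀ ∈ Φ i₁)
    (hΘ₀' : y₀' ∈ Φ i₁) (hy₁' : π y₁' = π y₁) (h11 : y₁ ≠ y₁') (hΘ₁ : y₁ ∈ Φ i₁) (hΘ₁' : y₁' ∉ Φ i₁)
    (hX : ∀ x : X, x = x₀ ∨ x = ρ • x₀ ∨ x = π y₁ ∨ x = ρ • π y₁) :
    typeRank G (sigmaType Φ) < Fintype.card (Σ k, E k) / 2 + 1 := by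
  haveI : Nonempty I := ⟨i₀⟩
  haveI : Nonempty (Σ k, E k) := ⟨⟨i₁, Classical.arbitrary _⟩⟩
  have hfr := finrank_antiSpan_sigmaType_eq_of_stabilizer_le h h01 hI π hπ hfib htrans hdeg hy₀ hy₀' h00 hΘ₀ hΘ₀'
    hy₁' h11 hΘ₁ hΘ₁' hX
  rw [(IsCMTypeWith.sigmaType h).typeRank_eq_finrank_antiSpan_add_one, hfr,
    ← (h i₁).typeRank_eq_finrank_antiSpan_add_one, card_sigma_div_two h]
  have hle := (h i₁).typeRank_le
  have h2 : 2 ≤ Fintype.card (E i₀) := by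
    obtain ⟨z⟩ := ‹Nonempty (E i₀)›
    have hne : ρ • z ≠ z := (h i₀).rho_smul_ne z
    exact Fintype.one_lt_card_iff_nontrivial.2 ⟨⟨ρ • z, z, hne⟩⟩
  have hsum : Fintype.card (E i₀) / 2 + Fintype.card (E i₁) / 2 ≤ ∑ k, Fintype.card (E k) / 2 := by
    rw [Fintype.sum_eq_add i₀ i₁ h01 (fun k hk => by
      rcases hI k with rfl | rfl
      · exact absurd rfl hk.1
      · exact absurd rfl hk.2)]
  omega

end Collapse

end Literature.NumberTheory.ComplexMultiplication

end
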